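import Summits.Langlands.Langlands.Statement
import Literature.NumberTheory.GaloisRepresentations.SymplecticMultiplier
import HarnessLib

/-!
# On-path lemma (F4) for the rung `SymplecticOddRegularQ 2` of line `SymplecticOddRegularQ2`
# (crux `ReciprocityUpToIrreducibility`, item stmt-Langlands-14328; G4 ladder-down, generation 4)

`Langlands → SymplecticOddRegularQ g` for every `0 < g` (in particular the rung `g = 2` and every
higher rung): clause (B) of the summit over `ℚ` at any reciprocity datum — one exists by the `Nonempty`
conjunct of the Statement — applies to every `ρ` on the sector, because the sector's de Rham clause is
stated against the PINNED Fontaine datum `fontainePstAdicCompletion v ℓ hv`, which is `Rec.pst ℓ v hv`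
by definition (`ReciprocityData.pst`), so the sector hypotheses give `IsGeometricFramed Rec ρ`;
`Corresponds Rec ι π ρ` contains a.e. Satake–Frobenius matching as its first conjunct.  The family is
VERBATIM the one of `Lines/SymplecticOddRegularQ2.lean`.  Sorry-free; standard axioms.
-/

noncomputable section

set_option linter.dupNamespace false

open scoped MatrixGroups Matrix NumberField Classical Polynomial
open Filter IsDedekindDomain Field Polynomial
open Literature.NumberTheory.Automorphic Literature.NumberTheory.GaloisRepresentations
open Literature.NumberTheory.PAdicHodge
open Summit.Langlands

namespace Summit.Langlands.Langlands.Cruxes.ReciprocityUpToIrreducibility.SymplecticOddRegularQ2.OnPath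

/-- **The rung family** (dial = genus `g`, rank `2g`): clause (B) of the summit over `ℚ` restricted to
the symplectic Fontaine–Mazur sector at odd `ℓ` — `ρ : Γ_ℚ → GL_{2g}(ℚ̄_ℓ)` irreducible, preserving a
non-degenerate alternating form up to a multiplier `μ` with `μ(c) = -1` at complex conjugation
(GSp-oddness, Boxer–Calegari–Gee–Pilloni 2021 §7.6), unramified a.e., de Rham at `ℓ` for the PINNED
Fontaine datum with pairwise distinct labelled Hodge–Tate weights — conclusion in a.e.-Satake form.
At `g = 1` it is (equivalent to, `floor_iff`) the tree item `DyadicOddResidue.OddPrimesRegularFM`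
(every rank-2 `ρ` is symplectic with multiplier `det ρ`). -/
def SymplecticOddRegularQ (g : ℕ) : Prop :=
  ∀ (ℓ : ℕ) [Fact ℓ.Prime], ℓ ≠ 2 →
    ∀ (ρ : Literature.NumberTheory.GaloisRepresentations.FramedGaloisRep ℚ (PadicAlgCl ℓ) (2 * g)),
      ρ.toGaloisRep.IsIrreducible →
      (∃ μ : Field.absoluteGaloisGroup ℚ → PadicAlgCl ℓ, ρ.IsSymplecticWithMultiplierFun μ ∧
        ∀ (φ : ℚ →+* ℝ) (c : Field.absoluteGaloisGroup ℚ),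
          Literature.NumberTheory.GaloisRepresentations.IsComplexConjugation φ c → μ c = -1) →
      (∀ᶠ v : IsDedekindDomain.HeightOneSpectrum (NumberField.RingOfIntegers ℚ) in Filter.cofinite,
        ρ.IsUnramifiedAt v) →
      (∀ (v : IsDedekindDomain.HeightOneSpectrum (NumberField.RingOfIntegers ℚ))
        (hv : ((ℓ : ℕ) : NumberField.RingOfIntegers ℚ) ∈ v.asIdeal),
        (Literature.NumberTheory.PAdicHodge.fontainePstAdicCompletion v ℓ hv).IsDeRhamFramed (ρ.toLocal v) ∧
        ∀ τ : v.adicCompletion ℚ →+* PadicAlgCl ℓ, Continuous τ →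
          (ρ.labelledHodgeTateWeightsAt v
            (Literature.NumberTheory.PAdicHodge.fontainePstAdicCompletion v ℓ hv).algebra
            (Literature.NumberTheory.PAdicHodge.fontainePstAdicCompletion v ℓ hv).𝔅 τ).Nodup) →
      ∀ (hcpt : Literature.NumberTheory.Automorphic.isCompact_glFiniteIntegralLevel (2 * g) ℚ)
        (ι : PadicAlgCl ℓ ≃+* ℂ),
        ∃ π : Literature.NumberTheory.Automorphic.CuspidalAutomorphicRepData (2 * g) ℚ hcpt,
          π.1.IsLAlgebraic ∧
          ∀ᶠ v : IsDedekindDomain.HeightOneSpectrum (NumberField.RingOfIntegers ℚ) in Filter.cofinite,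
            Summit.Langlands.SatakeFrobCompatibleAt ι π.1 ρ v

/-- **THE RUNG** (the filed statement): the family at genus `g = 2` — reciprocity (B) for regular,
odd, symplectic `ρ : Γ_ℚ → GL₄(ℚ̄_ℓ)` (`GSp₄`-type), `ℓ` odd. -/
def SymplecticOddRegularQ2 : Prop := SymplecticOddRegularQ 2

/-- **Dial monotonicity in the summit direction** (F4): the summit gives every rung `g ≥ 1`. -/
theorem symplecticOddRegularQ_of_langlands {g : ℕ} (hg : 0 < g) (hL : _root_.Langlands) :
    SymplecticOddRegularQ g := by
  intro ℓ _ _hℓ ρ hirr _hsymp hunr hdR hcpt ι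
  obtain ⟨⟨Rec⟩, hall⟩ := hL ℚ
  have hB : GaloisToAutomorphic (2 * g) Rec hcpt := (hall Rec (2 * g) (by omega) hcpt).2
  have hgeo : IsGeometricFramed Rec ρ := ⟨hunr, fun v hv => (hdR v hv).1⟩
  obtain ⟨π, hLalg, hcorr⟩ := hB ℓ ι ρ hirr hgeo
  exact ⟨π, hLalg, hcorr.1⟩

/-- **F4 on-path lemma for the rung**: `Langlands → SymplecticOddRegularQ2`. -/
@[aesop safe apply]
theorem SymplecticOddRegularQ2_of_Langlands (hL : _root_.Langlands) : SymplecticOddRegularQ2 :=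
  symplecticOddRegularQ_of_langlands (by norm_num) hL

end Summit.Langlands.Langlands.Cruxes.ReciprocityUpToIrreducibility.SymplecticOddRegularQ2.OnPath

end
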